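import Summits.Ventures.HodgeRepro2.T5QuadraticInertBridge
import Summits.Ventures.HodgeRepro2.T5InertPlaceFrobenius

/-!
# T5CMCensusPackage — the inert-place package of a CM field from the Legendre symbol alone

Tier-5 kernel support (seat p8, blind lane; sub-step N3).  For the record's CM field `E` over its
maximal totally real subfield `E⁺` (Mathlib's `NumberField.IsCMField`), written `E = E⁺(√d)` with
an integral `√d = x` (T5-177 shows such `x, d` exist), the whole inert-place package of
T5-146 … T5-171 — stated in T5-168 under the hypothesis «`v 𝓞_E = w`» — holds at every finite
place `v` of `E⁺` with `4d ∉ v` at which `d` is not a square modulo `v`: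

* `map_eq_asIdeal` — `v 𝓞_E = w` for every `w ∣ v` (the census, T5-174);
* `finrank_adicCompletion_eq_two`, `ramificationIdx'_eq_one`, `inertiaDeg'_eq_two`,
  `exists_algEquiv_ne_one`, `irreducible_algebraMap` — `[E_w : E⁺_v] = 2`, `e = 1`, `f = 2`, the
  non-trivial local automorphism exists, uniformisers stay uniformisers;
* `residue_galRestrict_eq_pow` — the local conjugation reduces to the Frobenius `x ↦ x^{q_v}`
  (T5-170);
* `exists_isInteger_conj_mul_eq_unit`, `exists_isotropic`, `heckeAlgebra_mul_comm` — the norm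
  theorem for units, the isotropy of every unimodular hermitian `3`-space over `E_w`, and the
  commutativity of the spherical Hecke algebra `H(U(H), K_H)` (T5-168), with the star of
  T5-125 on the derived local degree.

No `sorry`, no axiom beyond `propext`, `Classical.choice`, `Quot.sound`.
-/

namespace Summit.Ventures.HodgeRepro2.T5CMCensusPackage

open NumberField IsDedekindDomain HeightOneSpectrum

variable (E : Type*) [Field E] [NumberField E] [IsCMField E]
  {x : 𝓞 E} {d : 𝓞 (maximalRealSubfield E)}
  (v : HeightOneSpectrum (𝓞 (maximalRealSubfield E)))
  (hx : x * x = algebraMap (𝓞 (maximalRealSubfield E)) (𝓞 E) d)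
  (hx' : x ∉ Set.range (algebraMap (𝓞 (maximalRealSubfield E)) (𝓞 E)))
  (hv : 4 * d ∉ v.asIdeal) (hd : ¬ IsSquare (Ideal.Quotient.mk v.asIdeal d))
  (w : HeightOneSpectrum (𝓞 E)) [w.asIdeal.LiesOver v.asIdeal]

include hx hx' hv hd

/-- `d` not a square modulo `v` (`4d ∉ v`) ⇒ `v 𝓞_E = w` for every place `w ∣ v`. -/
theorem map_eq_asIdeal :
    v.asIdeal.map (algebraMap (𝓞 (maximalRealSubfield E)) (𝓞 E)) = w.asIdeal :=
  T5QuadraticConductor.map_eq_asIdeal_of_not_isSquare v (T5CMInertPlacePackage.finrank_eq_two_cm E)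
    hx hx' hv hd w

/-- `[E_w : E⁺_v] = 2`. -/
theorem finrank_adicCompletion_eq_two :
    Module.finrank (v.adicCompletion (maximalRealSubfield E)) (w.adicCompletion E) = 2 :=
  T5CMInertPlacePackage.finrank_adicCompletion_eq_two E v w (map_eq_asIdeal E v hx hx' hv hd w)

/-- `e(w/v) = 1`. -/
theorem ramificationIdx'_eq_one : v.asIdeal.ramificationIdx' w.asIdeal = 1 :=
  T5InertGlobalPrime.ramificationIdx'_eq_one_of_staysPrime v w (map_eq_asIdeal E v hx hx' hv hd w)

/-- `f(w/v) = 2`. -/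
theorem inertiaDeg'_eq_two : v.asIdeal.inertiaDeg' w.asIdeal = 2 :=
  T5InertGlobalPrime.inertiaDeg'_eq_two_of_staysPrime v w (T5CMInertPlacePackage.finrank_eq_two_cm E)
    (map_eq_asIdeal E v hx hx' hv hd w)

/-- The non-trivial automorphism of `E_w/E⁺_v` exists. -/
theorem exists_algEquiv_ne_one :
    ∃ σ : Gal(w.adicCompletion E/v.adicCompletion (maximalRealSubfield E)), σ ≠ 1 :=
  T5CMInertPlacePackage.exists_algEquiv_ne_one E v w (map_eq_asIdeal E v hx hx' hv hd w)

/-- Uniformisers of `E⁺_v` stay uniformisers in `E_w`. -/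
theorem irreducible_algebraMap {ϖ : v.adicCompletionIntegers (maximalRealSubfield E)}
    (hϖ : Irreducible ϖ) :
    Irreducible (algebraMap (v.adicCompletionIntegers (maximalRealSubfield E))
      (w.adicCompletionIntegers E) ϖ) :=
  T5CMInertPlacePackage.irreducible_algebraMap_of_inert E v w (map_eq_asIdeal E v hx hx' hv hd w) hϖ

/-- The local conjugation reduces to the Frobenius `y ↦ y^{q_v}` on the residue field (T5-170). -/
theorem residue_galRestrict_eq_pow
    (σ : Gal(w.adicCompletion E/v.adicCompletion (maximalRealSubfield E))) (hσ : σ ≠ 1)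
    (y : w.adicCompletionIntegers E) :
    letI := Fintype.ofFinite
      (IsLocalRing.ResidueField (v.adicCompletionIntegers (maximalRealSubfield E)))
    IsLocalRing.residue (w.adicCompletionIntegers E)
        (galRestrict (v.adicCompletionIntegers (maximalRealSubfield E))
          (v.adicCompletion (maximalRealSubfield E)) (w.adicCompletion E)
          (w.adicCompletionIntegers E) σ y) =
      IsLocalRing.residue (w.adicCompletionIntegers E) y ^
        Fintype.card (IsLocalRing.ResidueField (v.adicCompletionIntegers (maximalRealSubfield E))) :=
  T5InertPlaceFrobenius.residue_galRestrict_eq_pow v w (ramificationIdx'_eq_one E v hx hx' hv hd w)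
    (inertiaDeg'_eq_two E v hx hx' hv hd w) σ hσ y

/-- The norm theorem for units: every unit of `O_{E⁺_v}` is `σ z · z` with `z` integral. -/
theorem exists_isInteger_conj_mul_eq_unit {ϖ : v.adicCompletionIntegers (maximalRealSubfield E)}
    (hϖ : Irreducible ϖ)
    (σ : Gal(w.adicCompletion E/v.adicCompletion (maximalRealSubfield E))) (hσ : σ ≠ 1)
    (u : (v.adicCompletionIntegers (maximalRealSubfield E))ˣ) :
    ∃ z, IsLocalization.IsInteger
        (integralClosure (v.adicCompletionIntegers (maximalRealSubfield E)) (w.adicCompletion E)) z ∧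
      σ z * z = algebraMap (v.adicCompletionIntegers (maximalRealSubfield E)) (w.adicCompletion E) u :=
  T5CMInertPlacePackage.exists_isInteger_conj_mul_eq_unit_of_inert E v w
    (map_eq_asIdeal E v hx hx' hv hd w) hϖ σ hσ u

/-- Every unimodular `σ`-hermitian `3 × 3` form over `E_w` is isotropic (the star is T5-125's
`starRingOfQuadratic` on the derived `[E_w : E⁺_v] = 2`). -/
theorem exists_isotropic {ϖ : v.adicCompletionIntegers (maximalRealSubfield E)} (hϖ : Irreducible ϖ)
    (σ : Gal(w.adicCompletion E/v.adicCompletion (maximalRealSubfield E))) (hσ : σ ≠ 1)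
    {H : Matrix (Fin 3) (Fin 3) (w.adicCompletion E)} :
    letI := T5StarOfInvolution.starRingOfQuadratic
      (finrank_adicCompletion_eq_two E v hx hx' hv hd w) σ hσ
    H.IsHermitian → IsUnit H.det → ∃ y, y ≠ 0 ∧ T5UnitaryGroupIsometry.sesqForm H y y = 0 := by
  intro hH hdet
  exact T5CMInertPlacePackage.exists_isotropic_of_inert E v w (map_eq_asIdeal E v hx hx' hv hd w)
    hϖ σ hσ hH hdet

/-- The spherical Hecke algebra `H(U(H), K_H)` of the record's local unitary group at `v` is
commutative — from the Legendre symbol `(d / v) = −1` alone. -/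
theorem heckeAlgebra_mul_comm {ϖ : v.adicCompletionIntegers (maximalRealSubfield E)}
    (hϖ : Irreducible ϖ)
    (σ : Gal(w.adicCompletion E/v.adicCompletion (maximalRealSubfield E))) (hσ : σ ≠ 1)
    (H : Matrix (Fin 3) (Fin 3) (w.adicCompletion E)) (k : Type*) [Field k] :
    letI := T5StarOfInvolution.starRingOfQuadratic
      (finrank_adicCompletion_eq_two E v hx hx' hv hd w) σ hσ
    H.IsHermitian →
    (∀ i j, IsLocalization.IsInteger
      (integralClosure (v.adicCompletionIntegers (maximalRealSubfield E)) (w.adicCompletion E))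
      (H i j)) →
    IsUnit H.det →
    (∀ i j, IsLocalization.IsInteger
      (integralClosure (v.adicCompletionIntegers (maximalRealSubfield E)) (w.adicCompletion E))
      (H⁻¹ i j)) →
    ∀ T S : T5HeckePermutationModule.heckeAlgebra k
      (T5UnitaryHeckeAdjoint.hyperspecialSubgroup
        (integralClosure (v.adicCompletionIntegers (maximalRealSubfield E)) (w.adicCompletion E)) H),
    T * S = S * T := by
  intro hH hint hdet hinv T S
  exact T5CMInertPlacePackage.heckeAlgebra_mul_comm_of_inert E v w
    (map_eq_asIdeal E v hx hx' hv hd w) hϖ σ hσ H k hH hint hdet hinv T S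

end Summit.Ventures.HodgeRepro2.T5CMCensusPackage
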